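import Mathlib
import Summits.ResolutionOfSingularities.ResolutionOfSingularities.Theorems.WildQuotientsWildQuotientResolutionS1W1NOStep

/-!
# S1 / W1N cascade — Part IV: the packaged chart-1-at-0 set-up, brick B5, the Noether floor `4 ≤ μ` at a type-O node, S3

Crux stmt-ResolutionOfSingularities-17941 (`WildQuotients.CyclicQuotientFourfolds`), S1a line `s1a-logminvertex`,
stub `stub_W1N_print`, sub-line `w1n-cascade` (idea-1 `W1N-LINE.md`; proofs from `CombinedNStep.scratch.lean`
6995af6f748e7ae0).  [OURS · L1 W4.5c] — NOT a statement of the manuscript; counted 0 post-V5.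

Bricks shared by the supports `NStep` / `NTwoExit`: `exists_chart1_zero_setup` (strict transforms + exponent
bookkeeping + `μ(θ') = α·eG + β·fA + I(A,G)`), brick B5 (`not_isBadNode_of_span_eq_top`: unit offset ⇒ not bad),
the Noether floor `four_le_milnor_of_isSucc` and the terminal step S3 `not_isBadNode_of_milnor_le_four_of_isSucc`
(type O with `μ ≤ 4` has no bad isolated successor).  Imports W-4b `…S1W1NOStep` (colength identity, `ostep_arith`,
`OStep0`) and, through it, the B3 transport toolkit `…S1PlanarFieldTransportSwap` and the step tools.
-/

-- single-problem summit: the doubled namespace component `ResolutionOfSingularities` is forced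
set_option linter.dupNamespace false

noncomputable section

open MvPowerSeries IsLocalRing
open Literature.AlgebraicGeometry.Resolution
open Summit.ResolutionOfSingularities.ResolutionOfSingularities.Theorems.WildCones.MuDropCharTwoOrdP

namespace Summit.ResolutionOfSingularities.ResolutionOfSingularities.Theorems.WildQuotientResolution.S1.PlanarField

variable {κ : Type} [Field κ]

/-! ## Part IV — bricks shared by `NStep` / `NTwoExit`: the packaged chart-1-at-0 SET-UP, brick B5
(unit offset ⇒ not bad), the Noether floor `4 ≤ μ` at a type-O node, and the terminal step
`μ ≤ 4 ∧ type O ⇒ no bad isolated successor`. [OURS · L1 W4.5c] -/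

/-- THE CHART-1-AT-0 SET-UP (OSTEP-PLAN §2), packaged: strict transforms `A, B*, G` of `a, b, g := x·b − y·a`
with their axis data, the exponent bookkeeping `s + α = ma`, `s + 2 + β = mg`, saturation `α = 0 ∨ β = 0`,
`a' = x^α A`, `b' = x^β G`, the key identity `x^(s+1+β)·G = x^mb·B* − y·x^ma·A`, finiteness of `/(A, G)` and
`μ(θ') = α·eG + β·fA + I(A,G)` (with `eG = dim/(G,x)`, `fA = dim/(A,x)`). [OURS · L1 W4.5c] -/
theorem exists_chart1_zero_setup (θ θ' : PlanarField κ) (ha0 : θ.a ≠ 0) (hb0 : θ.b ≠ 0)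
    (hg0 : X 0 * θ.b - X 1 * θ.a ≠ 0) (hsucc : IsSuccChart1 0 θ θ') (hiso' : θ'.IsIsolated) :
    ∃ (A Bst G : MvPowerSeries (Fin 2) κ) (ma mb mg s α β : ℕ),
      (ma : ℕ∞) = θ.a.order ∧ (mb : ℕ∞) = θ.b.order ∧ (mg : ℕ∞) = (X 0 * θ.b - X 1 * θ.a).order ∧
      min ma mb + 1 ≤ mg ∧
      subst (![X 0, X 0 * X 1] : Fin 2 → MvPowerSeries (Fin 2) κ) θ.a = X 0 ^ ma * A ∧
      killCompl (⟨fun _ => (1 : Fin 2), fun a b _ => Subsingleton.elim a b⟩ : Fin 1 ↪ Fin 2) A ≠ 0 ∧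
      (killCompl (⟨fun _ => (1 : Fin 2), fun a b _ => Subsingleton.elim a b⟩ : Fin 1 ↪ Fin 2) A).order ≤
        (ma : ℕ∞) ∧
      subst (![X 0, X 0 * X 1] : Fin 2 → MvPowerSeries (Fin 2) κ) θ.b = X 0 ^ mb * Bst ∧
      killCompl (⟨fun _ => (1 : Fin 2), fun a b _ => Subsingleton.elim a b⟩ : Fin 1 ↪ Fin 2) Bst ≠ 0 ∧
      (killCompl (⟨fun _ => (1 : Fin 2), fun a b _ => Subsingleton.elim a b⟩ : Fin 1 ↪ Fin 2) Bst).order ≤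
        (mb : ℕ∞) ∧
      subst (![X 0, X 0 * X 1] : Fin 2 → MvPowerSeries (Fin 2) κ) (X 0 * θ.b - X 1 * θ.a) = X 0 ^ mg * G ∧
      killCompl (⟨fun _ => (1 : Fin 2), fun a b _ => Subsingleton.elim a b⟩ : Fin 1 ↪ Fin 2) G ≠ 0 ∧
      (killCompl (⟨fun _ => (1 : Fin 2), fun a b _ => Subsingleton.elim a b⟩ : Fin 1 ↪ Fin 2) G).order ≤
        (mg : ℕ∞) ∧
      s + α = ma ∧ s + 2 + β = mg ∧ (α = 0 ∨ β = 0) ∧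
      θ'.a = X 0 ^ α * A ∧ θ'.b = X 0 ^ β * G ∧
      X 0 ^ (s + 1 + β) * G = X 0 ^ mb * Bst - X 1 * X 0 ^ ma * A ∧
      Module.Finite κ (MvPowerSeries (Fin 2) κ ⧸ Ideal.span {A, G}) ∧
      θ'.milnor = α * Module.finrank κ (MvPowerSeries (Fin 2) κ ⧸ Ideal.span {G, (X 0 : MvPowerSeries (Fin 2) κ)}) +
        β * Module.finrank κ (MvPowerSeries (Fin 2) κ ⧸ Ideal.span {A, (X 0 : MvPowerSeries (Fin 2) κ)}) +
        Module.finrank κ (MvPowerSeries (Fin 2) κ ⧸ Ideal.span {A, G}) := by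
  obtain ⟨A, hA, hKA, hνA⟩ := exists_strict_transform ha0
  obtain ⟨Bst, hB, hKB, hνB⟩ := exists_strict_transform hb0
  obtain ⟨G, hG, hKG, hνG⟩ := exists_strict_transform hg0
  have hord := min_order_add_one_le θ.a θ.b
  set ma := θ.a.order.toNat with hma_def
  set mb := θ.b.order.toNat with hmb_def
  set mg := (X 0 * θ.b - X 1 * θ.a).order.toNat with hmg_def
  have hma : (ma : ℕ∞) = θ.a.order := ne_zero_iff_order_finite.mp ha0
  have hmb : (mb : ℕ∞) = θ.b.order := ne_zero_iff_order_finite.mp hb0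
  have hmg : (mg : ℕ∞) = (X 0 * θ.b - X 1 * θ.a).order := ne_zero_iff_order_finite.mp hg0
  have hmgb : min ma mb + 1 ≤ mg := by
    rw [← hma, ← hmb, ← hmg] at hord
    rcases le_total ma mb with h | h
    · rw [min_eq_left h]
      rw [min_eq_left (Nat.cast_le.mpr h : (ma : ℕ∞) ≤ mb)] at hord
      exact_mod_cast hord
    · rw [min_eq_right h]
      rw [min_eq_right (Nat.cast_le.mpr h : (mb : ℕ∞) ≤ ma)] at hord
      exact_mod_cast hord
  have hxA : ¬ (X 0 : MvPowerSeries (Fin 2) κ) ∣ A := (killCompl_ne_zero_iff_not_X_dvd A).mp hKA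
  have hxG : ¬ (X 0 : MvPowerSeries (Fin 2) κ) ∣ G := (killCompl_ne_zero_iff_not_X_dvd G).mp hKG
  -- the successor equations
  obtain ⟨s, h1, h2, hsat⟩ := hsucc
  have h2' := isSuccChart1_zero_eq θ θ' h2
  rw [chart1_zero_eq_blow, hA] at h1
  rw [chart1_zero_eq_blow, hG] at h2'
  obtain ⟨hs_ma, ha'⟩ := X_pow_cancel hxA h1
  obtain ⟨hs_mg, hb'⟩ := X_pow_cancel hxG h2'
  set α := ma - s with hα_def
  set β := mg - (s + 2) with hβ_def
  have hsα : s + α = ma := by omega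
  have hsβ : s + 2 + β = mg := by omega
  have hsat' : α = 0 ∨ β = 0 := by
    rcases Nat.eq_zero_or_pos α with hα | hα
    · exact Or.inl hα
    rcases Nat.eq_zero_or_pos β with hβ | hβ
    · exact Or.inr hβ
    exfalso
    apply hsat
    constructor
    · rw [ha']; exact Dvd.dvd.mul_right (dvd_pow_self (X 0) hα.ne') A
    · rw [hb']; exact Dvd.dvd.mul_right (dvd_pow_self (X 0) hβ.ne') G
  -- the key identity `x^(mg-1) G = x^mb B* − y x^ma A`
  have htr := X_zero_mul_transform θ.a θ.b
  rw [chart1_zero_eq_blow, hA, hB, hG] at htr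
  have hid : X 0 ^ (s + 1 + β) * G = X 0 ^ mb * Bst - X 1 * X 0 ^ ma * A := by
    apply mul_left_cancel₀ (X_zero_ne_zero (κ := κ))
    calc X 0 * (X 0 ^ (s + 1 + β) * G) = X 0 ^ mg * G := by rw [← hsβ]; ring
      _ = X 0 * (X 0 ^ mb * Bst - X 1 * (X 0 ^ ma * A)) := htr.symm
      _ = X 0 * (X 0 ^ mb * Bst - X 1 * X 0 ^ ma * A) := by ring
  -- `μ(θ')` by colength additivity, in both saturation cases
  have key : Module.Finite κ (MvPowerSeries (Fin 2) κ ⧸ Ideal.span {A, G}) ∧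
      θ'.milnor = α * Module.finrank κ (MvPowerSeries (Fin 2) κ ⧸ Ideal.span {G, (X 0 : MvPowerSeries (Fin 2) κ)}) +
        β * Module.finrank κ (MvPowerSeries (Fin 2) κ ⧸ Ideal.span {A, (X 0 : MvPowerSeries (Fin 2) κ)}) +
        Module.finrank κ (MvPowerSeries (Fin 2) κ ⧸ Ideal.span {A, G}) := by
    rcases hsat' with hα | hβ
    · have ha'' : θ'.a = A := by rw [ha', hα, pow_zero, one_mul]
      have hfin' : Module.Finite κ (MvPowerSeries (Fin 2) κ ⧸ Ideal.span {A, X 0 ^ β * G}) := by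
        have h := hiso'
        unfold IsIsolated at h
        rwa [ha'', hb'] at h
      obtain ⟨hfinAG, hcol⟩ := colength_X_pow_mul hxA β hfin'
      refine ⟨hfinAG, ?_⟩
      show Module.finrank κ (MvPowerSeries (Fin 2) κ ⧸ Ideal.span {θ'.a, θ'.b}) = _
      rw [ha'', hb', hcol, hα, zero_mul, zero_add]
    · have hb'' : θ'.b = G := by rw [hb', hβ, pow_zero, one_mul]
      have hfin' : Module.Finite κ (MvPowerSeries (Fin 2) κ ⧸ Ideal.span {G, X 0 ^ α * A}) := by
        have h := hiso'
        unfold IsIsolated at h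
        rwa [ha', hb'', Ideal.span_pair_comm] at h
      obtain ⟨hfinGA, hcol⟩ := colength_X_pow_mul hxG α hfin'
      have hfinAG : Module.Finite κ (MvPowerSeries (Fin 2) κ ⧸ Ideal.span {A, G}) := by
        rw [Ideal.span_pair_comm]; exact hfinGA
      refine ⟨hfinAG, ?_⟩
      show Module.finrank κ (MvPowerSeries (Fin 2) κ ⧸ Ideal.span {θ'.a, θ'.b}) = _
      rw [ha', hb'', Ideal.span_pair_comm, hcol, hβ, zero_mul, add_zero, Ideal.span_pair_comm (x := G) (y := A)]
  obtain ⟨hfinAG, hμ'⟩ := key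
  exact ⟨A, Bst, G, ma, mb, mg, s, α, β, hma, hmb, hmg, hmgb, hA, hKA, hνA, hB, hKB, hνB, hG, hKG, hνG,
    hsα, hsβ, hsat', ha', hb', hid, hfinAG, hμ'⟩

/-! ### Brick B5 — unit offset ⇒ not bad -/

/-- A nilpotent lower-triangular `2 × 2` matrix over a field has zero diagonal. [folklore] -/
theorem diag_eq_zero_of_isNilpotent {p q r : κ}
    (h : IsNilpotent (!![p, 0; q, r] : Matrix (Fin 2) (Fin 2) κ)) : p = 0 ∧ r = 0 := by
  have htr : p + r = 0 := by
    have := (Matrix.isNilpotent_trace_of_isNilpotent h).eq_zero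
    rwa [Matrix.trace_fin_two_of] at this
  have hdet : p * r = 0 := by
    obtain ⟨m, hm⟩ := h
    have : IsNilpotent (Matrix.det (!![p, 0; q, r] : Matrix (Fin 2) (Fin 2) κ)) :=
      ⟨m, by rw [← Matrix.det_pow, hm, Matrix.det_zero]⟩
    have h0 := this.eq_zero
    rw [Matrix.det_fin_two_of] at h0
    simpa using h0
  rcases mul_eq_zero.mp hdet with hp | hr
  · refine ⟨hp, ?_⟩; rwa [hp, zero_add] at htr
  · refine ⟨?_, hr⟩; rwa [hr, add_zero] at htr

/-- `coeff x (x·A) = A(0,0)` and `coeff y (x·A) = 0`; `coeff y (y·A) = A(0,0)` and `coeff x (y·A) = 0`. [folklore] -/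
theorem coeff_single_X_mul (i j : Fin 2) (A : MvPowerSeries (Fin 2) κ) :
    coeff (Finsupp.single j 1) (X i * A) = if i = j then constantCoeff A else 0 := by
  classical
  rw [X_def, coeff_monomial_mul]
  by_cases hij : i = j
  · subst hij
    rw [if_pos le_rfl, tsub_self, one_mul, coeff_zero_eq_constantCoeff_apply, if_pos rfl]
  · rw [if_neg hij, if_neg]
    intro hle
    have := Finsupp.le_def.mp hle i
    rw [Finsupp.single_eq_same, Finsupp.single_eq_of_ne hij] at this
    exact Nat.not_succ_le_zero 0 this

/-- In the local ring `κ⟦x,y⟧`, `(A, B) = ⊤` forces one of `A`, `B` to be a unit. [folklore] -/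
theorem isUnit_or_isUnit_of_span_pair_eq_top {A B : MvPowerSeries (Fin 2) κ}
    (htop : Ideal.span ({A, B} : Set (MvPowerSeries (Fin 2) κ)) = ⊤) : IsUnit A ∨ IsUnit B := by
  by_contra hcon
  rcases not_or.mp hcon with ⟨hA, hB⟩
  have hle : Ideal.span ({A, B} : Set (MvPowerSeries (Fin 2) κ)) ≤ maximalIdeal (MvPowerSeries (Fin 2) κ) := by
    rw [Ideal.span_le]
    intro z hz
    simp only [Set.mem_insert_iff, Set.mem_singleton_iff] at hz
    rcases hz with rfl | rfl
    · exact (mem_maximalIdeal _).mpr (mem_nonunits_iff.mpr hA)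
    · exact (mem_maximalIdeal _).mpr (mem_nonunits_iff.mpr hB)
  rw [htop, top_le_iff] at hle
  exact (maximalIdeal.isMaximal (MvPowerSeries (Fin 2) κ)).ne_top hle

/-- **BRICK B5 (unit offset ⇒ not bad).**  In the chart-1-at-0 set-up at a node whose two components have
the SAME order `ν` (so `s + α = ν`, `s + 2 + β = mg ≥ ν + 1`, `a' = x^α A`, `b' = x^β G`,
`x^(s+1+β) G = x^ν B* − y x^ν A`, saturation), if the strict transforms generate the unit ideal,
`(A, B*) = ⊤` — i.e. the intersection number `I(A, B*)` at the successor vanishes — then the successor is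
NOT a bad node: either a component is a unit, or `θ' = (x·A, B* − y·A)` with `A` a unit, whose linear part
`[[A(0), 0], [*, B*_y(0) − A(0)]]` is lower-triangular with a non-zero diagonal entry. [OURS · L1 W4.5c] -/
theorem not_isBadNode_of_span_eq_top {θ' : PlanarField κ} {A Bst G : MvPowerSeries (Fin 2) κ}
    {ν mg s α β : ℕ} (hmg : ν + 1 ≤ mg) (hsα : s + α = ν) (hsβ : s + 2 + β = mg) (hsat : α = 0 ∨ β = 0)
    (ha' : θ'.a = X 0 ^ α * A) (hb' : θ'.b = X 0 ^ β * G)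
    (hid : X 0 ^ (s + 1 + β) * G = X 0 ^ ν * Bst - X 1 * X 0 ^ ν * A)
    (htop : Ideal.span ({A, Bst} : Set (MvPowerSeries (Fin 2) κ)) = ⊤) : ¬ θ'.IsBadNode := by
  classical
  have hunit := isUnit_or_isUnit_of_span_pair_eq_top htop
  rintro ⟨⟨ha0', hb0'⟩, hnil⟩
  have hcX0 : constantCoeff (X 0 : MvPowerSeries (Fin 2) κ) = 0 := constantCoeff_X 0
  have hcX1 : constantCoeff (X 1 : MvPowerSeries (Fin 2) κ) = 0 := constantCoeff_X 1
  -- exponent analysis: `α = 0`, or `α = 1 ∧ β = 0`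
  have hcases : α = 0 ∨ (α = 1 ∧ β = 0) := by
    rcases hsat with hα | hβ
    · exact Or.inl hα
    · rcases Nat.eq_zero_or_pos α with hα | hα
      · exact Or.inl hα
      · exact Or.inr ⟨by omega, hβ⟩
  rcases hcases with hα | ⟨hα, hβ⟩
  · -- α = 0 : `a' = A`, `s = ν`
    have ha'' : θ'.a = A := by rw [ha', hα, pow_zero, one_mul]
    rcases hunit with hAu | hBu
    · rw [ha''] at ha0'
      exact (isUnit_iff_constantCoeff.mp hAu).ne_zero ha0'
    · have hs : s = ν := by omega
      have hid' : X 0 ^ (1 + β) * G = Bst - X 1 * A := by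
        apply mul_left_cancel₀ (pow_ne_zero ν (X_zero_ne_zero (κ := κ)))
        calc X 0 ^ ν * (X 0 ^ (1 + β) * G) = X 0 ^ (s + 1 + β) * G := by rw [hs]; ring
          _ = X 0 ^ ν * Bst - X 1 * X 0 ^ ν * A := hid
          _ = X 0 ^ ν * (Bst - X 1 * A) := by ring
      have hc := congrArg constantCoeff hid'
      rw [map_mul, map_pow, hcX0, zero_pow (by omega), zero_mul, map_sub, map_mul, hcX1, zero_mul,
        sub_zero] at hc
      exact (isUnit_iff_constantCoeff.mp hBu).ne_zero hc.symm
  · -- α = 1, β = 0 : `a' = x A`, `b' = G = B* − y A`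
    have ha'' : θ'.a = X 0 * A := by rw [ha', hα, pow_one]
    have hb'' : θ'.b = G := by rw [hb', hβ, pow_zero, one_mul]
    have hs : s + 1 = ν := by omega
    have hGeq : G = Bst - X 1 * A := by
      apply mul_left_cancel₀ (pow_ne_zero ν (X_zero_ne_zero (κ := κ)))
      calc X 0 ^ ν * G = X 0 ^ (s + 1 + β) * G := by rw [hβ, add_zero, hs]
        _ = X 0 ^ ν * Bst - X 1 * X 0 ^ ν * A := hid
        _ = X 0 ^ ν * (Bst - X 1 * A) := by ring
    rcases hunit with hAu | hBu
    · -- linear part is lower-triangular with diagonal (A(0), B*_y(0) − A(0))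
      have h00 : θ'.linearPart 0 0 = constantCoeff A := by
        simp only [linearPart, Matrix.of_apply, if_true]
        rw [ha'', coeff_single_X_mul, if_pos rfl]
      have h01 : θ'.linearPart 0 1 = 0 := by
        simp only [linearPart, Matrix.of_apply, if_true]
        rw [ha'', coeff_single_X_mul, if_neg Fin.zero_ne_one]
      have h11 : θ'.linearPart 1 1 = coeff (Finsupp.single 1 1) Bst - constantCoeff A := by
        simp only [linearPart, Matrix.of_apply, if_neg one_ne_zero]
        rw [hb'', hGeq, map_sub, coeff_single_X_mul, if_pos rfl]
      have hL : θ'.linearPart = !![constantCoeff A, 0; θ'.linearPart 1 0,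
          coeff (Finsupp.single 1 1) Bst - constantCoeff A] := by
        ext i j
        fin_cases i <;> fin_cases j
        · simpa using h00
        · simpa using h01
        · simp
        · simpa using h11
      rw [hL] at hnil
      obtain ⟨hA0, -⟩ := diag_eq_zero_of_isNilpotent hnil
      exact (isUnit_iff_constantCoeff.mp hAu).ne_zero hA0
    · rw [hb'', hGeq, map_sub, map_mul, hcX1, zero_mul, sub_zero] at hb0'
      exact (isUnit_iff_constantCoeff.mp hBu).ne_zero hb0'

/-! ### The Noether floor at a type-O node, and the terminal step -/

/-- A finite quotient of `κ`-dimension `0` is the quotient by `⊤`. [folklore] -/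
theorem eq_top_of_finrank_eq_zero {I : Ideal (MvPowerSeries (Fin 2) κ)}
    (hfin : Module.Finite κ (MvPowerSeries (Fin 2) κ ⧸ I)) (h0 : Module.finrank κ (MvPowerSeries (Fin 2) κ ⧸ I) = 0) :
    I = ⊤ := by
  haveI := hfin
  have : Subsingleton (MvPowerSeries (Fin 2) κ ⧸ I) := Module.finrank_zero_iff.mp h0
  exact Ideal.Quotient.subsingleton_iff.mp this

/-- NOETHER FLOOR AT A TYPE-O NODE (chart 1 at 0): an isolated bad node with `linearPart = 0` that has an
isolated chart-1-at-0 successor satisfies `I(A, B*) + ord a · ord b ≤ μ`, in particular `4 ≤ μ`.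
[OURS · L1 W4.5c] -/
theorem four_le_milnor_of_isSuccChart1_zero (θ θ' : PlanarField κ) (hiso : θ.IsIsolated) (hbad : θ.IsBadNode)
    (hL : θ.linearPart = 0) (hsucc : IsSuccChart1 0 θ θ') (hiso' : θ'.IsIsolated) : 4 ≤ θ.milnor := by
  obtain ⟨hsing, -⟩ := hbad
  obtain ⟨ha0, hb0⟩ := ne_zero_of_isIsolated θ hiso hsing
  obtain ⟨h2a, h2b⟩ := (linearPart_eq_zero_iff_two_le_order θ hsing).mp hL
  have hg0 : X 0 * θ.b - X 1 * θ.a ≠ 0 := X_mul_sub_ne_zero θ hiso h2a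
  obtain ⟨A, Bst, G, ma, mb, mg, s, α, β, hma, hmb, hmg, hmgb, hA, hKA, hνA, hB, hKB, hνB, hG, hKG, hνG,
    hsα, hsβ, hsat, ha', hb', hid, hfinAG, hμ'⟩ := exists_chart1_zero_setup θ θ' ha0 hb0 hg0 hsucc hiso'
  have h2a' : 2 ≤ ma := by rw [← hma] at h2a; exact_mod_cast h2a
  have h2b' : 2 ≤ mb := by rw [← hmb] at h2b; exact_mod_cast h2b
  obtain ⟨hfinAB, -⟩ := colength_identity hKA hid hfinAG
  have hF1 : Module.finrank κ (MvPowerSeries (Fin 2) κ ⧸ Ideal.span {A, Bst}) + ma * mb ≤ θ.milnor :=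
    noether_inequality (mf := ma) (mg := mb) hma.le hmb.le hA hB hKA
      (hνA.trans (by exact_mod_cast Nat.le_add_right ma mb)) hiso hfinAB
  have h4 : 4 ≤ ma * mb := Nat.mul_le_mul h2a' h2b'
  omega

/-- THE TERMINAL STEP (chart 1 at 0): an isolated bad node of type O with `μ ≤ 4` has NO bad isolated
chart-1-at-0 successor — Noether forces `ord a = ord b = 2` and `I(A, B*) = 0`, and brick B5 applies.
[OURS · L1 W4.5c] -/
theorem not_isBadNode_of_milnor_le_four (θ θ' : PlanarField κ) (hiso : θ.IsIsolated) (hbad : θ.IsBadNode)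
    (hL : θ.linearPart = 0) (hμ : θ.milnor ≤ 4) (hsucc : IsSuccChart1 0 θ θ') (hiso' : θ'.IsIsolated) :
    ¬ θ'.IsBadNode := by
  obtain ⟨hsing, -⟩ := hbad
  obtain ⟨ha0, hb0⟩ := ne_zero_of_isIsolated θ hiso hsing
  obtain ⟨h2a, h2b⟩ := (linearPart_eq_zero_iff_two_le_order θ hsing).mp hL
  have hg0 : X 0 * θ.b - X 1 * θ.a ≠ 0 := X_mul_sub_ne_zero θ hiso h2a
  obtain ⟨A, Bst, G, ma, mb, mg, s, α, β, hma, hmb, hmg, hmgb, hA, hKA, hνA, hB, hKB, hνB, hG, hKG, hνG,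
    hsα, hsβ, hsat, ha', hb', hid, hfinAG, hμ'⟩ := exists_chart1_zero_setup θ θ' ha0 hb0 hg0 hsucc hiso'
  have h2a' : 2 ≤ ma := by rw [← hma] at h2a; exact_mod_cast h2a
  have h2b' : 2 ≤ mb := by rw [← hmb] at h2b; exact_mod_cast h2b
  obtain ⟨hfinAB, -⟩ := colength_identity hKA hid hfinAG
  have hF1 : Module.finrank κ (MvPowerSeries (Fin 2) κ ⧸ Ideal.span {A, Bst}) + ma * mb ≤ θ.milnor :=
    noether_inequality (mf := ma) (mg := mb) hma.le hmb.le hA hB hKA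
      (hνA.trans (by exact_mod_cast Nat.le_add_right ma mb)) hiso hfinAB
  have h4 : 4 ≤ ma * mb := Nat.mul_le_mul h2a' h2b'
  have hma2 : ma = 2 := by
    by_contra hne
    have h3 : 3 ≤ ma := by omega
    have : 6 ≤ ma * mb := Nat.mul_le_mul h3 h2b'
    omega
  have hmb2 : mb = 2 := by
    by_contra hne
    have h3 : 3 ≤ mb := by omega
    have : 6 ≤ ma * mb := Nat.mul_le_mul h2a' h3
    omega
  have hI0 : Module.finrank κ (MvPowerSeries (Fin 2) κ ⧸ Ideal.span {A, Bst}) = 0 := by omega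
  have htop := eq_top_of_finrank_eq_zero hfinAB hI0
  rw [hma2, hmb2] at hmgb
  rw [hma2] at hsα hid
  rw [hmb2] at hid
  exact not_isBadNode_of_span_eq_top (ν := 2) (mg := mg) (by simpa using hmgb) hsα hsβ hsat ha' hb' hid htop

/-- NOETHER FLOOR AT A TYPE-O NODE, any successor: an isolated bad node with `linearPart = 0` having an
isolated successor has `4 ≤ μ` (via the B3 transport). [OURS · L1 W4.5c] -/
theorem four_le_milnor_of_isSucc (θ θ' : PlanarField κ) (hiso : θ.IsIsolated) (hbad : θ.IsBadNode)
    (hL : θ.linearPart = 0) (hsucc : θ.IsSucc θ') (hiso' : θ'.IsIsolated) : 4 ≤ θ.milnor := by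
  revert hiso hbad hL hiso'
  refine forall_isSucc_of_chart1_zero
    (P := fun θ θ' => θ.IsIsolated → θ.IsBadNode → θ.linearPart = 0 → θ'.IsIsolated → 4 ≤ θ.milnor)
    ?_ ?_ ?_ θ θ' hsucc
  · intro c θ θ' h hiso hbad hL hiso'
    have := h ((isIsolated_shear_iff c θ).mpr hiso) ((isBadNode_shear_iff c θ).mpr hbad)
      ((linearPart_shear_eq_zero_iff c θ).mpr hL) hiso'
    rwa [milnor_shear] at this
  · intro θ θ' h hiso hbad hL hiso'
    have := h ((isIsolated_swapField_iff θ).mpr hiso) ((isBadNode_swapField_iff θ).mpr hbad)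
      ((linearPart_swapField_eq_zero_iff θ).mpr hL) ((isIsolated_swapField_iff θ').mpr hiso')
    rwa [milnor_swapField] at this
  · intro θ θ' h hiso hbad hL hiso'
    exact four_le_milnor_of_isSuccChart1_zero θ θ' hiso hbad hL h hiso'

/-- **THE TERMINAL STEP**, any successor: an isolated bad node of type O with `μ ≤ 4` has no bad isolated
successor. (Third step of `NTwoExit`; also the `e = 3` corner sub-case of `NStep`.) [OURS · L1 W4.5c] -/
theorem not_isBadNode_of_milnor_le_four_of_isSucc (θ θ' : PlanarField κ) (hiso : θ.IsIsolated)
    (hbad : θ.IsBadNode) (hL : θ.linearPart = 0) (hμ : θ.milnor ≤ 4) (hsucc : θ.IsSucc θ')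
    (hiso' : θ'.IsIsolated) : ¬ θ'.IsBadNode := by
  revert hiso hbad hL hμ hiso'
  refine forall_isSucc_of_chart1_zero
    (P := fun θ θ' => θ.IsIsolated → θ.IsBadNode → θ.linearPart = 0 → θ.milnor ≤ 4 → θ'.IsIsolated →
      ¬ θ'.IsBadNode)
    ?_ ?_ ?_ θ θ' hsucc
  · intro c θ θ' h hiso hbad hL hμ hiso'
    exact h ((isIsolated_shear_iff c θ).mpr hiso) ((isBadNode_shear_iff c θ).mpr hbad)
      ((linearPart_shear_eq_zero_iff c θ).mpr hL) (by rwa [milnor_shear]) hiso'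
  · intro θ θ' h hiso hbad hL hμ hiso' hbad'
    exact h ((isIsolated_swapField_iff θ).mpr hiso) ((isBadNode_swapField_iff θ).mpr hbad)
      ((linearPart_swapField_eq_zero_iff θ).mpr hL) (by rwa [milnor_swapField])
      ((isIsolated_swapField_iff θ').mpr hiso') ((isBadNode_swapField_iff θ').mpr hbad')
  · intro θ θ' h hiso hbad hL hμ hiso'
    exact not_isBadNode_of_milnor_le_four θ θ' hiso hbad hL hμ h hiso'

end Summit.ResolutionOfSingularities.ResolutionOfSingularities.Theorems.WildQuotientResolution.S1.PlanarField

end
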